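import Summits.CriticalPhenomena.PercolationContinuityZ3.Theorems.PercNearOneGluingNoHeavyPcintClusterExploration
import Summits.CriticalPhenomena.PercolationContinuityZ3.Theorems.PercNearOneGluingNoHeavyPcintAdaptiveDominationTools
import HarnessLib

/-!
# PCINT lane, king route, K1 step (3), structural part: the examination tree along a run of the cluster exploration

Cell `prim-pcint`, seat `prim-pcint-1` (gen 9); memo `run/shared/lean/prim/pcint/KING-ROUTE.md` §K1 (3).

Facts about the states `τ_k = run (ClusterExpl.rule G enc o) x k` of the cluster exploration (any oracle `x`) that
the Markov decomposition of van den Berg–Ermakov's local law (K1 step (3)) rests on — "the factor graph of a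
transcript is a tree":

* `rule_eq_filter_of_sel`, `exists_sel_of_mem_rule` — at a non-initial step with selected site `b`, the examined
  sites are exactly the unrevealed neighbours of `b`, and `b` is revealed true (`sel_revealedTrue`);
* `exists_step_of_run_ne_none` — every revealed site was examined at some earlier step, and keeps the value reported
  then (`run_apply_eq_of_mem_rule`);
* `step_unique_of_mem_rule` — **a site is examined at most once**;
* `sel_ne_of_sel_eq` — **a site is selected at most once** (after its step all its neighbours are revealed);
* `run_apply_eq_none_of_le`, `not_mem_rule_of_run_apply_eq_none`, `sel_ne_of_run_apply_eq_none` — a site unrevealed at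
  step `n` was unrevealed, not examined and not selected before; `exists_examiner` — the examiner of a revealed site.
-/

namespace Summit.CriticalPhenomena.PercolationContinuityZ3.Theorems.Pcint

namespace ClusterExpl

open Finset AdaptDom

variable {V : Type*} [Fintype V] [DecidableEq V] (G : SimpleGraph V) [DecidableRel G.Adj] (enc : V → ℕ) (o : V)

omit [DecidableEq V] in
/-- At a non-initial state with selected site `b`, the rule examines exactly the unrevealed neighbours of `b`. -/
theorem rule_eq_filter_of_sel {σ : V → Option Bool} (hne : ¬ ∀ v, σ v = none) {b : V} (hsel : sel G enc σ = some b) :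
    rule G enc o σ = univ.filter fun w => G.Adj b w ∧ σ w = none := by
  unfold rule; rw [if_neg hne, hsel]

omit [DecidableEq V] in
/-- At a non-initial state, an examined site is an unrevealed neighbour of the selected site, which is revealed true. -/
theorem exists_sel_of_mem_rule {σ : V → Option Bool} (hne : ¬ ∀ v, σ v = none) {a : V} (ha : a ∈ rule G enc o σ) :
    ∃ b, sel G enc σ = some b ∧ σ b = some true ∧ G.Adj b a ∧ σ a = none := by
  cases hsel : sel G enc σ with
  | none => rw [rule_eq_empty_of_sel_eq_none G enc o hne hsel] at ha; simp at ha
  | some b =>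
    rw [rule_eq_filter_of_sel G enc o hne hsel, mem_filter] at ha
    exact ⟨b, rfl, (mem_filter.1 (sel_spec G enc hsel).1).2.1, ha.2.1, ha.2.2⟩

omit [DecidableEq V] in
/-- A selected site is revealed true and has an unrevealed neighbour. -/
theorem sel_revealedTrue {σ : V → Option Bool} {b : V} (hsel : sel G enc σ = some b) :
    σ b = some true ∧ ∃ w, G.Adj b w ∧ σ w = none :=
  (mem_filter.1 (sel_spec G enc hsel).1).2

/-- The initial (empty) state is the state of step `0` only: from step `1` on the root is revealed. -/
theorem not_initial_run_succ (x : (V → Option Bool) → V → Bool) (n : ℕ) :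
    ¬ ∀ v, run (rule G enc o) x (n + 1) v = none :=
  fun h => run_root_ne_none G enc o x (n + 1) (Nat.le_add_left 1 n) (h o)

/-- **The value reported at the examination step persists**: if `a` is examined at step `k` then at every later
step `m > k` the state records `some (x τ_k a)`. -/
theorem run_apply_eq_of_mem_rule (x : (V → Option Bool) → V → Bool) {k : ℕ} {a : V}
    (ha : a ∈ rule G enc o (run (rule G enc o) x k)) {m : ℕ} (hm : k < m) :
    run (rule G enc o) x m a = some (x (run (rule G enc o) x k) a) := by
  have h1 := run_succ_apply_of_mem x k ha
  have h2 := run_apply_of_ne_none (rule_unrevealed G enc o) x (n := k + 1) (v := a) (by rw [h1]; simp) m hm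
  rw [h2, h1]

/-- **Every revealed site was examined at an earlier step.** -/
theorem exists_step_of_run_ne_none (x : (V → Option Bool) → V → Bool) :
    ∀ (n : ℕ) (a : V), run (rule G enc o) x n a ≠ none → ∃ k < n, a ∈ rule G enc o (run (rule G enc o) x k)
  | 0, a, h => by simp [run] at h
  | n + 1, a, h => by
    by_cases hprev : run (rule G enc o) x n a = none
    · -- revealed exactly at this step
      refine ⟨n, Nat.lt_succ_self n, ?_⟩
      by_contra hna
      apply h
      change stepPA (rule G enc o (run (rule G enc o) x n)) (run (rule G enc o) x n) (x (run (rule G enc o) x n)) a = none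
      unfold stepPA; rw [if_neg hna]; exact hprev
    · obtain ⟨k, hk, hka⟩ := exists_step_of_run_ne_none x n a hprev
      exact ⟨k, hk.trans (Nat.lt_succ_self n), hka⟩

/-- **A site is examined at most once.** -/
theorem step_unique_of_mem_rule (x : (V → Option Bool) → V → Bool) {j k : ℕ} {a : V}
    (hj : a ∈ rule G enc o (run (rule G enc o) x j)) (hk : a ∈ rule G enc o (run (rule G enc o) x k)) : j = k := by
  by_contra hne
  rcases Nat.lt_or_gt_of_ne hne with h | h
  · have h1 := run_apply_eq_of_mem_rule G enc o x hj h
    have h2 := rule_unrevealed G enc o _ a hk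
    rw [h2] at h1; exact absurd h1 (by simp)
  · have h1 := run_apply_eq_of_mem_rule G enc o x hk h
    have h2 := rule_unrevealed G enc o _ a hj
    rw [h2] at h1; exact absurd h1 (by simp)

/-- **A site unrevealed at step `n` was unrevealed at every earlier step.** -/
theorem run_apply_eq_none_of_le (x : (V → Option Bool) → V → Bool) {k n : ℕ} (hkn : k ≤ n) {a : V}
    (ha : run (rule G enc o) x n a = none) : run (rule G enc o) x k a = none := by
  by_contra h
  have := run_apply_of_ne_none (rule_unrevealed G enc o) x h n hkn
  rw [ha] at this
  exact h this.symm

/-- A site unrevealed at step `n` was not examined before step `n`. -/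
theorem not_mem_rule_of_run_apply_eq_none (x : (V → Option Bool) → V → Bool) {k n : ℕ} (hkn : k < n) {a : V}
    (ha : run (rule G enc o) x n a = none) : a ∉ rule G enc o (run (rule G enc o) x k) := by
  intro hk
  have := run_apply_eq_of_mem_rule G enc o x hk hkn
  rw [ha] at this; exact absurd this (by simp)

/-- A site unrevealed at step `n` was not selected at any step `k ≤ n` (selected sites are revealed true). -/
theorem sel_ne_of_run_apply_eq_none (x : (V → Option Bool) → V → Bool) {k n : ℕ} (hkn : k ≤ n) {a : V}
    (ha : run (rule G enc o) x n a = none) : sel G enc (run (rule G enc o) x k) ≠ some a := by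
  intro hsel
  have h1 := (sel_revealedTrue G enc hsel).1
  have h2 := run_apply_eq_none_of_le G enc o x hkn ha
  rw [h2] at h1; exact absurd h1 (by simp)

/-- After the step at which `b` is selected (at a non-initial state), every neighbour of `b` is revealed. -/
theorem run_succ_apply_ne_none_of_sel (x : (V → Option Bool) → V → Bool) {k : ℕ} {b : V}
    (hne : ¬ ∀ v, run (rule G enc o) x k v = none) (hsel : sel G enc (run (rule G enc o) x k) = some b)
    {w : V} (hbw : G.Adj b w) : run (rule G enc o) x (k + 1) w ≠ none := by
  by_cases hw : run (rule G enc o) x k w = none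
  · have hmem : w ∈ rule G enc o (run (rule G enc o) x k) := by
      rw [rule_eq_filter_of_sel G enc o hne hsel, mem_filter]; exact ⟨mem_univ _, hbw, hw⟩
    rw [run_succ_apply_of_mem x k hmem]; simp
  · rw [run_apply_of_ne_none (rule_unrevealed G enc o) x hw (k + 1) (Nat.le_succ k)]; exact hw

/-- **A site is selected at most once**: if `b` is selected at the non-initial step `k`, it is not selected at any
later step (all its neighbours are revealed from step `k + 1` on, so it is no longer a candidate). -/
theorem sel_ne_of_sel_eq (x : (V → Option Bool) → V → Bool) {k m : ℕ} {b : V}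
    (hne : ¬ ∀ v, run (rule G enc o) x k v = none) (hsel : sel G enc (run (rule G enc o) x k) = some b) (hkm : k < m) :
    sel G enc (run (rule G enc o) x m) ≠ some b := by
  intro hm
  obtain ⟨-, w, hbw, hw⟩ := sel_revealedTrue G enc hm
  have h1 := run_succ_apply_ne_none_of_sel G enc o x hne hsel hbw
  have h2 := run_apply_of_ne_none (rule_unrevealed G enc o) x h1 m hkm
  rw [hw] at h2
  exact h1 h2.symm

/-- **The examiner of a revealed site**: a site revealed at step `n ≥ 1` other than by the root step was examined
from a site `b` selected at an earlier non-initial step, adjacent to it, and records the value reported then. -/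
theorem exists_examiner (x : (V → Option Bool) → V → Bool) {n : ℕ} {a : V} (ha : run (rule G enc o) x n a ≠ none)
    (hao : a ≠ o) :
    ∃ k < n, ∃ b, ¬ (∀ v, run (rule G enc o) x k v = none) ∧ sel G enc (run (rule G enc o) x k) = some b ∧
      G.Adj b a ∧ a ∈ rule G enc o (run (rule G enc o) x k) ∧
      run (rule G enc o) x n a = some (x (run (rule G enc o) x k) a) := by
  obtain ⟨k, hk, hka⟩ := exists_step_of_run_ne_none G enc o x n a ha
  have hne : ¬ ∀ v, run (rule G enc o) x k v = none := by
    intro hinit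
    have hr : rule G enc o (run (rule G enc o) x k) = {o} := by rw [rule, if_pos hinit]
    rw [hr, mem_singleton] at hka
    exact hao hka
  obtain ⟨b, hsel, -, hba, -⟩ := exists_sel_of_mem_rule G enc o hne hka
  exact ⟨k, hk, b, hne, hsel, hba, hka, run_apply_eq_of_mem_rule G enc o x hka hk⟩

end ClusterExpl

end Summit.CriticalPhenomena.PercolationContinuityZ3.Theorems.Pcint
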